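import Literature.NumberTheory.PAdicHodge.AinfWeierstrassTorsionLiftAdd
import Literature.NumberTheory.PAdicHodge.AinfWeierstrassOmegaPeriod
import Literature.NumberTheory.EllipticCurves.FormalGroupLogHomAbelProofs
import Literature.NumberTheory.EllipticCurves.FormalLogExpBaseChangeProofs
import HarnessLib

/-!
# The ω-period is additive: `∫_{t ⊕ t'} ω = ∫_t ω + ∫_{t'} ω` in `B_dR⁺(F)`

Topic `Literature/NumberTheory/PAdicHodge`; assembly of `AinfWeierstrassTorsionLiftAdd` (`[t ⊕ t'] = [t] ⊕_W [t']` in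
`Ŵ(𝔫) ⊂ 𝔸_inf`, a `(p, ξ)`-adic statement), `AinfWeierstrassOmegaPeriod` (`∫_t ω = log_W([t]) ∈ Fil¹B_dR⁺`, a
`ξ`-adic evaluation) and the tree's `formalLog_subst_formalGroupLaw` (`log_W(F(z₁,z₂)) = log_W z₁ + log_W z₂`,
AEC IV.5.2). The two topologies are bridged on `ker θ = ξ𝔸_inf`:

* §1 `AinfXiTop F p` — `𝔸_inf` with its `ξ`-ADIC topology (complete Hausdorff by the tree's
  `isAdicComplete_span_xi`), `kerTheta` = `(ξ)` as a `LubinTate.NilIdeal`, and the two CONTINUOUS identity-like maps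
  `toTop : AinfXiTop → AinfTop` (the `ξ`-adic topology is finer than the `(p, ξ)`-adic one) and
  `toBdR : AinfXiTop → BdRPlusTop` (`ξ ↦ ξ_dR`);
* §2 `toTop_evalPt`, `toBdR_evalPt` — for points of `ker θ`, evaluation of an integral power series computed
  `(p, ξ)`-adically in `𝔸_inf`, `ξ`-adically in `𝔸_inf`, or `ξ`-adically in `B_dR⁺` agree (Mathlib `comp_aeval`); hence
  **`ofAinf_evalPt`**: `𝔸_inf → B_dR⁺` commutes with evaluation at points of `ker θ`;
* §3 `evalPt_map_int` — change of coefficients `ℤ → ℚ` in `B_dR⁺`; `logSeries_eq_formalLog` (`log_W` over `RatCoeff`);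
* §4 **`omegaPeriod_addSeq : ∫_{t ⊕ t'} ω = ∫_t ω + ∫_{t'} ω`** — with `gal_omegaPeriod` this makes
  `t ↦ ∫_t ω` a `Γ_F`-equivariant additive map `T_pŴ(𝒪_{ℂ_F}) → Fil¹B_dR⁺(F)` (Fontaine 1982 §5; Colmez 1992 §2), the
  ω-half of the `p`-adic period pairing of `Ŵ`.

Definitions (reviewed): `AinfXiTop` (+ instances), `AinfXiTop.of`, `kerTheta`, `toTop`, `toBdR`, an `Algebra ℚ RatCoeff`
instance. No named facts, no `sorry`. Nothing about elliptic curves over number fields is proved here.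

## References
* J.-M. Fontaine, *Formes différentielles et modules de Tate des variétés abéliennes sur les corps locaux*,
  Invent. Math. 65 (1982), §5. [Fontaine1982FormesDifferentielles]
* J.-M. Fontaine, *Le corps des périodes p-adiques*, Astérisque 223 (1994), Exp. II §1.3, §1.5. [FontaineAsterisque223III]
* J. H. Silverman, *The Arithmetic of Elliptic Curves* (2009), IV.5.2. [SilvermanAEC2009]
-/

noncomputable section

open Ideal Field WittVector MvPowerSeries

namespace Literature.NumberTheory.PAdicHodge

open Literature.NumberTheory.GaloisRepresentations
open Literature.NumberTheory.GaloisRepresentations.IsNonarchimedeanLocalField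
open Literature.NumberTheory.GaloisRepresentations.LubinTate

variable (F : Type) [Field F] [ValuativeRel F] [TopologicalSpace F] [IsNonarchimedeanLocalField F] [CharZero F]
  (p : ℕ) [Fact p.Prime] [Fact (¬ IsUnit (p : integerC F))]
  [IsAdicComplete (Ideal.span {(p : integerC F)}) (integerC F)]

/-! ## §1 `𝔸_inf` with the `ξ`-adic topology -/

/-- **`𝔸_inf(F)` with its `ξ`-adic (`ker θ`-adic) topology** (type synonym). [cite: FontaineAsterisque223III, Exp. II §1.3] -/
def AinfXiTop : Type := Ainf (p := p) F

namespace AinfXiTop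

/-- Ring structure (that of `𝔸_inf`). [folklore] -/
instance : CommRing (AinfXiTop F p) := inferInstanceAs (CommRing (Ainf (p := p) F))

/-- The preferred ideal `(ξ) = ker θ`. [cite: FontaineAsterisque223III, Exp. II §1.3] -/
instance : WithIdeal (AinfXiTop F p) := ⟨(Ideal.span {(xi : Ainf (p := p) F)} : Ideal (Ainf (p := p) F))⟩

/-- The identification `𝔸_inf = AinfXiTop` (identity). [folklore] -/
def of : Ainf (p := p) F ≃+* AinfXiTop F p := RingEquiv.refl _

omit [CharZero F] [IsAdicComplete (Ideal.span {(p : integerC F)}) (integerC F)] in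
/-- The defining ideal is `(ξ)`. [cite: FontaineAsterisque223III, Exp. II §1.3] -/
theorem ideal_eq : (WithIdeal.i : Ideal (AinfXiTop F p)) = Ideal.span {of F p xi} := rfl

omit [CharZero F] [IsAdicComplete (Ideal.span {(p : integerC F)}) (integerC F)] in
/-- The topology is the `ξ`-adic one. [cite: FontaineAsterisque223III, Exp. II §1.3] -/
theorem isAdic : IsAdic (WithIdeal.i : Ideal (AinfXiTop F p)) := rfl

/-- `𝔸_inf` is `ξ`-adically complete (tree `isAdicComplete_span_xi`). [cite: FontaineAsterisque223III, Exp. II §1.3.1] -/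
instance : CompleteSpace (AinfXiTop F p) :=
  ((isAdic F p).isAdicComplete_iff.1 (isAdicComplete_span_xi (F := F) (p := p))).1

/-- `𝔸_inf` is `ξ`-adically Hausdorff. [cite: FontaineAsterisque223III, Exp. II §1.3.1] -/
instance : T2Space (AinfXiTop F p) :=
  ((isAdic F p).isAdicComplete_iff.1 (isAdicComplete_span_xi (F := F) (p := p))).2

omit [CharZero F] [IsAdicComplete (Ideal.span {(p : integerC F)}) (integerC F)] in
/-- `(ξ)` is closed (an open subgroup). [cite: FontaineAsterisque223III, Exp. II §1.3] -/
theorem isClosed_ideal : IsClosed ((WithIdeal.i : Ideal (AinfXiTop F p)) : Set (AinfXiTop F p)) := by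
  have h1 : ((WithIdeal.i ^ 1 : Ideal (AinfXiTop F p)) : Set (AinfXiTop F p)) ∈ nhds (0 : AinfXiTop F p) :=
    (Ideal.hasBasis_nhds_zero_adic (WithIdeal.i : Ideal (AinfXiTop F p))).mem_of_mem trivial
  rw [pow_one] at h1
  exact (⟨(WithIdeal.i : Ideal (AinfXiTop F p)).toAddSubgroup,
    (WithIdeal.i : Ideal (AinfXiTop F p)).toAddSubgroup.isOpen_of_mem_nhds h1⟩ : OpenAddSubgroup (AinfXiTop F p)).isClosed

/-- **`ker θ = (ξ)` as a closed nil ideal of the `ξ`-adic ring `𝔸_inf`.** [cite: FontaineAsterisque223III, Exp. II §1.3] -/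
def kerTheta : NilIdeal (AinfXiTop F p) where
  toIdeal := WithIdeal.i
  isClosed := isClosed_ideal F p
  isTopologicallyNilpotent _ ha := WithIdeal.isTopologicallyNilpotent_of_mem ha

/-- `AinfXiTop → AinfTop` (the identity of `𝔸_inf`; `ξ`-adic to `(p, ξ)`-adic). [cite: FontaineAsterisque223III, Exp. II §1.3] -/
def toTop : AinfXiTop F p →+* AinfTop F p := (AinfTop.of F p).toRingHom.comp (of F p).symm.toRingHom

/-- `AinfXiTop → BdRPlusTop` (`𝔸_inf → B_dR⁺`). [cite: FontaineAsterisque223III, Exp. II §1.5.2] -/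
def toBdR : AinfXiTop F p →+* BdRPlusTop F p := (BdRPlusTop.ofAinf F p).comp (of F p).symm.toRingHom

omit [CharZero F] [IsAdicComplete (Ideal.span {(p : integerC F)}) (integerC F)] in
/-- **`toTop` is continuous** (`(ξ)ⁿ ⊆ (p, ξ)ⁿ`). [cite: FontaineAsterisque223III, Exp. II §1.3] -/
theorem continuous_toTop : Continuous (toTop F p) := by
  refine (WithIdeal.uniformContinuous_of_map_le ?_).continuous
  rw [ideal_eq, Ideal.map_span, Ideal.span_le, Set.image_singleton, Set.singleton_subset_iff, SetLike.mem_coe,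
    AinfTop.ideal_eq]
  exact Ideal.subset_span (by simp [toTop, of])

omit [CharZero F] in
/-- **`toBdR` is continuous** (`ξ ↦ ξ_dR`). [cite: FontaineAsterisque223III, Exp. II §1.5.2] -/
theorem continuous_toBdR : Continuous (toBdR F p) := by
  refine (WithIdeal.uniformContinuous_of_map_le ?_).continuous
  rw [ideal_eq, Ideal.map_span, Ideal.span_le, Set.image_singleton, Set.singleton_subset_iff, SetLike.mem_coe,
    BdRPlusTop.ideal_eq]
  exact Ideal.subset_span (by simp [toBdR, of, BdRPlusTop.ofAinf_xi])

variable {F p}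

/-! ## §2 Evaluation at points of `ker θ` in the three topologies -/

/-- **`(p,ξ)`-adic and `ξ`-adic evaluation agree on `ker θ`**: for an integral power series `f` and points `xᵢ ∈ (ξ)`,
`toTop (f(x)) = f(toTop x)`. [cite: FontaineAsterisque223III, Exp. II §1.3] -/
theorem toTop_evalPt {hθ : Function.Surjective (fontaineTheta (integerC F) p)} {ι : Type*} [Finite ι]
    (f : MvPowerSeries ι ℤ) (hf : f.constantCoeff = 0) (x : ι → (kerTheta F p).toIdeal)
    (y : ι → (AinfTop.nilTheta F p hθ).toIdeal) (hxy : ∀ i, toTop F p (x i) = y i) :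
    toTop F p (evalPt (kerTheta F p) f hf x : AinfXiTop F p) = (evalPt (AinfTop.nilTheta F p hθ) f hf y : AinfTop F p) := by
  rw [coe_evalPt, coe_evalPt]
  have h := MvPowerSeries.comp_aeval ((kerTheta F p).hasEval x) (ε := (toTop F p).toIntAlgHom) (continuous_toTop F p)
  have h' := AlgHom.congr_fun h f
  rw [AlgHom.comp_apply, RingHom.toIntAlgHom_apply] at h'
  rw [h']
  exact aeval_congr_point _ _ (funext hxy) f

/-- **`ξ`-adic evaluation in `𝔸_inf` and in `B_dR⁺` agree**: `toBdR (f(x)) = f(toBdR x)`.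
[cite: FontaineAsterisque223III, Exp. II §1.5.2] -/
theorem toBdR_evalPt {ι : Type*} [Finite ι] (f : MvPowerSeries ι ℤ) (hf : f.constantCoeff = 0)
    (x : ι → (kerTheta F p).toIdeal) (z : ι → (BdRPlusTop.filOne F p).toIdeal) (hxz : ∀ i, toBdR F p (x i) = z i) :
    toBdR F p (evalPt (kerTheta F p) f hf x : AinfXiTop F p) = (evalPt (BdRPlusTop.filOne F p) f hf z : BdRPlusTop F p) := by
  rw [coe_evalPt, coe_evalPt]
  have h := MvPowerSeries.comp_aeval ((kerTheta F p).hasEval x) (ε := (toBdR F p).toIntAlgHom) (continuous_toBdR F p)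
  have h' := AlgHom.congr_fun h f
  rw [AlgHom.comp_apply, RingHom.toIntAlgHom_apply] at h'
  rw [h']
  exact aeval_congr_point _ _ (funext hxz) f

/-- **`𝔸_inf → B_dR⁺` commutes with evaluation at points of `ker θ`** (integral coefficients): for points `yᵢ ∈ 𝔫`
with `yᵢ ∈ ker θ`, `ofAinf (f(y)) = f(ofAinf y)` where the left evaluation is `(p, ξ)`-adic and the right one
`ξ`-adic. [cite: FontaineAsterisque223III, Exp. II §1.5.2] -/
theorem ofAinf_evalPt {hθ : Function.Surjective (fontaineTheta (integerC F) p)} {ι : Type*} [Finite ι]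
    (f : MvPowerSeries ι ℤ) (hf : f.constantCoeff = 0) (y : ι → (AinfTop.nilTheta F p hθ).toIdeal)
    (hy : ∀ i, (AinfTop.of F p).symm (y i) ∈ Ideal.span {(xi : Ainf (p := p) F)})
    (z : ι → (BdRPlusTop.filOne F p).toIdeal) (hyz : ∀ i, BdRPlusTop.ofAinf F p ((AinfTop.of F p).symm (y i)) = z i) :
    BdRPlusTop.ofAinf F p ((AinfTop.of F p).symm (evalPt (AinfTop.nilTheta F p hθ) f hf y : AinfTop F p)) =
      (evalPt (BdRPlusTop.filOne F p) f hf z : BdRPlusTop F p) := by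
  set x : ι → (kerTheta F p).toIdeal := fun i => ⟨of F p ((AinfTop.of F p).symm (y i)), hy i⟩ with hx
  rw [← toTop_evalPt f hf x y (fun i => rfl), ← toBdR_evalPt f hf x z (fun i => hyz i)]
  rfl

end AinfXiTop

/-! ## §3 Coefficients `ℤ → ℚ` in `B_dR⁺`, and `log_W` over `RatCoeff` -/

/-- `RatCoeff` as a `ℚ`-algebra (it is `ℚ`). [folklore] -/
instance RatCoeff.instAlgebraRat : Algebra ℚ RatCoeff := inferInstanceAs (Algebra ℚ ℚ)

/-- `RatCoeff` is a domain. [folklore] -/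
instance RatCoeff.instIsDomain : IsDomain RatCoeff := inferInstanceAs (IsDomain ℚ)

namespace BdRPlusTop

variable {F p}

/-- **Change of coefficients `ℤ → ℚ`** for evaluation in `B_dR⁺`. [cite: FontaineAsterisque223III, Exp. II §1.5.4] -/
theorem evalPt_map_int {ι : Type*} [Finite ι] (f : MvPowerSeries ι ℤ) (hf : f.constantCoeff = 0)
    (hf' : (MvPowerSeries.map (Int.castRingHom RatCoeff) f).constantCoeff = 0) (z : ι → (filOne F p).toIdeal) :
    (evalPt (filOne F p) f hf z : BdRPlusTop F p) = evalPt (filOne F p) (MvPowerSeries.map (Int.castRingHom RatCoeff) f) hf' z := by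
  rw [coe_evalPt, coe_evalPt, aeval_eq_sum, aeval_eq_sum]
  congr 1
  funext d
  simp only [MvPowerSeries.coeff_map, Algebra.smul_def, eq_intCast, map_intCast]

omit [CharZero F] [Fact p.Prime] [Fact (¬ IsUnit (p : integerC F))] [IsAdicComplete (Ideal.span {(p : integerC F)}) (integerC F)] in
/-- Constant coefficient after the change of coefficients. [cite: SilvermanAEC2009, IV.2.3] -/
theorem constantCoeff_map_int_eq_zero {ι : Type*} {f : MvPowerSeries ι ℤ} (hf : f.constantCoeff = 0) :
    (MvPowerSeries.map (Int.castRingHom RatCoeff) f).constantCoeff = 0 := by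
  rw [MvPowerSeries.constantCoeff_map, hf]
  rfl

end BdRPlusTop

namespace AinfTop

variable {F p}
variable {hθ : Function.Surjective (fontaineTheta (integerC F) p)} (W : WeierstrassCurve ℤ)

omit [CharZero F] [Fact p.Prime] [Fact (¬ IsUnit (p : integerC F))] [IsAdicComplete (Ideal.span {(p : integerC F)}) (integerC F)] in
/-- `log_W` over `RatCoeff` is the formal logarithm of the base-changed equation. [cite: SilvermanAEC2009, IV.5.5] -/
theorem logSeries_eq_formalLog : logSeries W = (W.map (Int.castRingHom RatCoeff)).formalLog := by
  have h : RatCoeff.of.toRingHom.comp (Int.castRingHom ℚ) = Int.castRingHom RatCoeff := RingHom.ext_int _ _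
  rw [logSeries, WeierstrassCurve.map_formalLog, WeierstrassCurve.map_map, ← h]

omit [CharZero F] [Fact p.Prime] [Fact (¬ IsUnit (p : integerC F))] [IsAdicComplete (Ideal.span {(p : integerC F)}) (integerC F)] in
/-- The chord–tangent law over `RatCoeff` is the base change of the integral one. [cite: SilvermanAEC2009, IV.2.3] -/
theorem map_formalGroupLaw_ratCoeff :
    MvPowerSeries.map (Int.castRingHom RatCoeff) W.formalGroupLaw = (W.map (Int.castRingHom RatCoeff)).formalGroupLaw :=
  WeierstrassCurve.map_formalGroupLaw _ _

/-! ## §4 Additivity of the ω-period -/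

/-- `[t]`, `[t']` and the sum, read in `Fil¹ B_dR⁺`: `ofAinf [t ⊕ t'] = F(ofAinf [t], ofAinf [t'])` (`ξ`-adic evaluation
of the integral law in `B_dR⁺`). [cite: FontaineAsterisque223III, Exp. II §1.5.2] -/
theorem coe_torsionLiftFil_addSeq {t t' : ℕ → (maxNilIdealC F).toIdeal} (ht0 : (t 0 : CBall F) = 0)
    (ht0' : (t' 0 : CBall F) = 0) (htp : ∀ n, mulPC F p W (t (n + 1)) = t n) (htp' : ∀ n, mulPC F p W (t' (n + 1)) = t' n) :
    (torsionLiftFil W hθ (addSeq F W t t') (coe_addSeq_zero W ht0 ht0') (mulPC_addSeq W htp htp') : BdRPlusTop F p) =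
      (evalPt (BdRPlusTop.filOne F p) W.formalGroupLaw W.constantCoeff_formalGroupLaw
        ![torsionLiftFil W hθ t ht0 htp, torsionLiftFil W hθ t' ht0' htp'] : BdRPlusTop F p) := by
  rw [coe_torsionLiftFil, torsionLift_addSeq W htp htp', addW]
  exact AinfXiTop.ofAinf_evalPt W.formalGroupLaw W.constantCoeff_formalGroupLaw _
    (fun i => by
      fin_cases i
      · exact torsionLift_mem_span_xi W ht0 htp
      · exact torsionLift_mem_span_xi W ht0' htp')
    _ (fun i => by fin_cases i <;> rfl)

/-- **Additivity of the ω-period: `∫_{t ⊕ t'} ω = ∫_t ω + ∫_{t'} ω` in `B_dR⁺(F)`** for `[p]`-compatible torsion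
sequences `t, t'` of `Ŵ(𝔪_{ℂ_F})` (AEC IV.5.2 `log_W(F(z₁,z₂)) = log_W z₁ + log_W z₂` evaluated `ξ`-adically at
`([t], [t'])`, and `[t ⊕ t'] = [t] ⊕_W [t']`). [cite: Fontaine1982FormesDifferentielles, §5] [cite: SilvermanAEC2009, IV.5.2] -/
theorem omegaPeriod_addSeq {t t' : ℕ → (maxNilIdealC F).toIdeal} (ht0 : (t 0 : CBall F) = 0)
    (ht0' : (t' 0 : CBall F) = 0) (htp : ∀ n, mulPC F p W (t (n + 1)) = t n) (htp' : ∀ n, mulPC F p W (t' (n + 1)) = t' n) :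
    omegaPeriod W hθ (addSeq F W t t') (coe_addSeq_zero W ht0 ht0') (mulPC_addSeq W htp htp') =
      omegaPeriod W hθ t ht0 htp + omegaPeriod W hθ t' ht0' htp' := by
  set V := W.map (Int.castRingHom RatCoeff) with hV
  set T := torsionLiftFil W hθ t ht0 htp
  set T' := torsionLiftFil W hθ t' ht0' htp'
  have hFq : (MvPowerSeries.map (Int.castRingHom RatCoeff) W.formalGroupLaw).constantCoeff = 0 :=
    BdRPlusTop.constantCoeff_map_int_eq_zero W.constantCoeff_formalGroupLaw
  -- the point `[t ⊕ t']` of `Fil¹` is `F_ℚ(T, T')`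
  have hpt : torsionLiftFil W hθ (addSeq F W t t') (coe_addSeq_zero W ht0 ht0') (mulPC_addSeq W htp htp') =
      evalPt (BdRPlusTop.filOne F p) V.formalGroupLaw V.constantCoeff_formalGroupLaw ![T, T'] := by
    apply Subtype.ext
    rw [coe_torsionLiftFil_addSeq W ht0 ht0' htp htp', BdRPlusTop.evalPt_map_int _ _ hFq]
    exact congrArg Subtype.val (evalPt_congr (BdRPlusTop.filOne F p) (map_formalGroupLaw_ratCoeff W) hFq
      V.constantCoeff_formalGroupLaw ![T, T'])
  -- `log_V(F_V(T, T')) = (log_V ∘ F_V)(T, T') = (log_V z₁ + log_V z₂)(T, T')`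
  have hlog0 : PowerSeries.constantCoeff V.formalLog = 0 := V.constantCoeff_formalLog
  have hsub0 : (V.formalLog.subst V.formalGroupLaw).constantCoeff = 0 :=
    constantCoeff_subst_zero (σ := Unit) (fun _ => V.constantCoeff_formalGroupLaw) hlog0
  have hX0 : ∀ i : Fin 2, (V.formalLog.subst (MvPowerSeries.X i : MvPowerSeries (Fin 2) RatCoeff)).constantCoeff = 0 :=
    fun i => constantCoeff_subst_zero (σ := Unit) (fun _ => MvPowerSeries.constantCoeff_X i) hlog0
  have hsum0 : (V.formalLog.subst (MvPowerSeries.X 0 : MvPowerSeries (Fin 2) RatCoeff) +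
      V.formalLog.subst (MvPowerSeries.X 1 : MvPowerSeries (Fin 2) RatCoeff)).constantCoeff = 0 := by
    rw [map_add, hX0 0, hX0 1, add_zero]
  rw [omegaPeriod, omegaPeriod, omegaPeriod, hpt]
  have hl : ∀ (x : (BdRPlusTop.filOne F p).toIdeal),
      (evalPt₁ (BdRPlusTop.filOne F p) (logSeries W) (constantCoeff_logSeries W) x : BdRPlusTop F p) =
        evalPt₁ (BdRPlusTop.filOne F p) V.formalLog hlog0 x := fun x =>
    congrArg Subtype.val (evalPt_congr (BdRPlusTop.filOne F p) (ι := Unit) (logSeries_eq_formalLog W)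
      (constantCoeff_logSeries W) hlog0 fun _ => x)
  rw [hl, hl, hl, ← evalPt₁_subst (BdRPlusTop.filOne F p) V.formalGroupLaw V.constantCoeff_formalGroupLaw V.formalLog hlog0 hsub0,
    evalPt_congr (BdRPlusTop.filOne F p) V.formalLog_subst_formalGroupLaw hsub0 hsum0 ![T, T'], coe_evalPt, map_add,
    ← coe_evalPt (BdRPlusTop.filOne F p) _ (hX0 0), ← coe_evalPt (BdRPlusTop.filOne F p) _ (hX0 1),
    evalPt₁_subst (BdRPlusTop.filOne F p) (MvPowerSeries.X 0 : MvPowerSeries (Fin 2) RatCoeff) (MvPowerSeries.constantCoeff_X 0)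
      V.formalLog hlog0 (hX0 0),
    evalPt₁_subst (BdRPlusTop.filOne F p) (MvPowerSeries.X 1 : MvPowerSeries (Fin 2) RatCoeff) (MvPowerSeries.constantCoeff_X 1)
      V.formalLog hlog0 (hX0 1), evalPt_X, evalPt_X]
  rfl

end AinfTop

end Literature.NumberTheory.PAdicHodge

end
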